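import Mathlib
import HarnessLib
import Summits.NavierStokesRegularity.NavierStokesRegularity.Theorems.PoloidalWindowRigidity.Negative.TriSheetProfile
import Literature.Algebra.EuclideanLattices.FccBccLattices

/-!
# Crux `PoloidalWindowRigidity` (K2, stmt-NavierStokesRegularity-19708) — negative side:
# the three-sheet profile has slice energy `≳ R²(−t)^{-1/2}`, so the THIN-ENERGY clause (ix) of
# the rev-12 draft removes it

Negative-side support (refuter seat ns-regularity-refuter1 gen 2; D-0081 §C), sequel of `…Negative.TriSheetProfile`.

The rev-12 draft of the residue stub (`stub_residueThinEnergy`, worker ns-poloidal-K2-p3 g3, 2026-08-27) adds, as the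
last hypothesis, the (M)-consequence «(ix) for every `3/2 < α ≤ 3` there is `K ≥ 0` with
`∫_{B̄(0,R)} ‖v(t)‖² ≤ K R^α (−t)^{−(α−1)/2}` for all `t < 0`, `R > 0`» (a THEOREM of the Type-I mild class,
`…LargeScaleEnergyBootstrapLevels.exists_level_of_gt_three_halves`).  This file certifies that the clause BITES
the three-sheet witness of `…Negative.TriSheetProfile`: on the sheared box
`{3/(10c) ≤ x₀ + x₂ ≤ 1/(2c), |x₁| ≤ R/4, |x₂| ≤ R/8} ⊆ B̄(0,R)` (`c = (−t)^{-1/2}`, `R ≥ 4√(−t)`) one has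
`‖v(t,x)‖² ≥ v₀² = c²β(c(x₀+x₂))² ≥ c²/36`, and the box has volume `R²/(40c)` (a transvection of an axis box,
Lebesgue-measure preserving), whence `∫_{B̄(0,R)} ‖v(t)‖² ≥ c R²/1440` (`sheetProfile_energy_lower`); at
`t = −1`, `α = 7/4`, `R = (1440K + 4)⁴` this contradicts (ix) (`sheetProfile_not_thinEnergy`).

Reading for the lead: the slice-energy growth exponent in similarity variables is the quantity clause (ix)
measures — `3` for the cellular / three-wave witnesses, `2` for sheets (this file), `≤ 3/2` demanded; wave-cone
profiles with a cross-section of finite two-dimensional energy have exponent `1` and are not removed by (ix).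

WHAT THIS IS NOT: not a claim about Navier–Stokes and not a refutation of the rev-12 stub (which keeps (M));
kinematics of an explicit non-mild profile. [folklore]
-/

noncomputable section

-- the summit and its single sub-problem share the name (CONVENTIONS §1), as in every Theorems file
set_option linter.dupNamespace false

namespace Summit.NavierStokesRegularity.NavierStokesRegularity.Theorems.PoloidalWindowRigidity.Negative

open MeasureTheory Set Function Filter Topology Metric
open scoped RealInnerProductSpace InnerProductSpace ENNReal NNReal
open Literature.Analysis Literature.Analysis.FluidPDE

/-! ## The shear `(x₀, x₁, x₂) ↦ (x₀ + x₂, x₁, x₂)` -/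

/-- The transvection `x ↦ x + x₂ e₀` on `Fin 3 → ℝ`, in coordinates. [folklore] -/
theorem transvection_zero_two_apply (y : Fin 3 → ℝ) :
    Matrix.toLin' (Matrix.TransvectionStruct.toMatrix ⟨(0 : Fin 3), 2, by decide, (1 : ℝ)⟩) y =
      ![y 0 + y 2, y 1, y 2] := by
  rw [Matrix.TransvectionStruct.toMatrix_mk, Matrix.toLin'_apply]
  ext i
  fin_cases i <;>
    simp [Matrix.mulVec, dotProduct, Fin.sum_univ_three, Matrix.transvection, Matrix.single_apply,
      Matrix.one_apply]

/-! ## The lower energy bound -/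

/-- **Slice energy of the three-sheet profile from below**: for `t < 0` and `R ≥ 4√(−t)`,
`∫_{B̄(0,R)} ‖v(t)‖² ≥ (−t)^{-1/2} R²/1440`. [folklore] -/
theorem sheetProfile_energy_lower {t : ℝ} (ht : t < 0) {R : ℝ} (hR : 4 / cellAmp t ≤ R) :
    cellAmp t * R ^ 2 / 1440 ≤
      ∫ x in Metric.closedBall (0 : EuclideanSpace ℝ (Fin 3)) R, ‖sheetProfile t x‖ ^ 2 := by
  have hc : 0 < cellAmp t := cellAmp_pos ht
  have hR0 : 0 < R := lt_of_lt_of_le (by positivity) hR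
  have hcR : 1 / (2 * cellAmp t) ≤ R / 8 := by
    rw [div_le_iff₀ hc] at hR
    rw [div_le_iff₀ (by positivity)]
    linarith
  -- the axis box in the sheared coordinates `(x₀ + x₂, x₁, x₂)`
  set lo : Fin 3 → ℝ := ![3 / (10 * cellAmp t), -(R / 4), -(R / 8)] with hlo
  set hi : Fin 3 → ℝ := ![1 / (2 * cellAmp t), R / 4, R / 8] with hhi
  have hlohi : lo ≤ hi := by
    intro i
    fin_cases i
    · show 3 / (10 * cellAmp t) ≤ 1 / (2 * cellAmp t)
      rw [div_le_div_iff₀ (by positivity) (by positivity)]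
      linarith
    · show -(R / 4) ≤ R / 4
      linarith
    · show -(R / 8) ≤ R / 8
      linarith
  -- the shear, a Lebesgue-measure-preserving map `E³ → (Fin 3 → ℝ)`
  set Φ : EuclideanSpace ℝ (Fin 3) → (Fin 3 → ℝ) := fun x =>
    Matrix.toLin' (Matrix.TransvectionStruct.toMatrix ⟨(0 : Fin 3), 2, by decide, (1 : ℝ)⟩) (WithLp.ofLp x)
    with hΦ
  have hΦmp : MeasurePreserving Φ volume volume :=
    (Real.volume_preserving_transvectionStruct _).comp (PiLp.volume_preserving_ofLp (Fin 3))
  have hΦapply : ∀ x : EuclideanSpace ℝ (Fin 3), Φ x = ![x 0 + x 2, x 1, x 2] := by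
    intro x
    simp only [hΦ]
    exact transvection_zero_two_apply _
  set P : Set (EuclideanSpace ℝ (Fin 3)) := Φ ⁻¹' Set.Icc lo hi with hP
  have hPmeas : MeasurableSet P := measurableSet_Icc.preimage hΦmp.measurable
  have hPvol : volume P = volume (Set.Icc lo hi) := hΦmp.measure_preimage measurableSet_Icc.nullMeasurableSet
  have hvolIcc : (volume (Set.Icc lo hi)).toReal = R ^ 2 / (40 * cellAmp t) := by
    rw [Real.volume_Icc_pi_toReal hlohi, Fin.prod_univ_three]
    simp only [hlo, hhi, Matrix.cons_val_zero, Matrix.cons_val_one, Matrix.cons_val_two, Matrix.head_cons,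
      Matrix.tail_cons]
    field_simp
    ring
  -- membership in `P`, in coordinates
  have hPmem : ∀ x : EuclideanSpace ℝ (Fin 3), x ∈ P →
      (3 / (10 * cellAmp t) ≤ x 0 + x 2 ∧ x 0 + x 2 ≤ 1 / (2 * cellAmp t)) ∧ |x 1| ≤ R / 4 ∧ |x 2| ≤ R / 8 := by
    intro x hx
    have hx' : lo ≤ Φ x ∧ Φ x ≤ hi := hx
    rw [hΦapply] at hx'
    obtain ⟨h1, h2⟩ := hx'
    have a0 := h1 0
    have a1 := h1 1
    have a2 := h1 2
    have b0 := h2 0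
    have b1 := h2 1
    have b2 := h2 2
    simp only [hlo, hhi, Matrix.cons_val_zero, Matrix.cons_val_one, Matrix.cons_val_two, Matrix.head_cons,
      Matrix.tail_cons] at a0 a1 a2 b0 b1 b2
    exact ⟨⟨a0, b0⟩, abs_le.2 ⟨a1, b1⟩, abs_le.2 ⟨a2, b2⟩⟩
  -- `P ⊆ B̄(0, R)`
  have hPsub : P ⊆ Metric.closedBall (0 : EuclideanSpace ℝ (Fin 3)) R := by
    intro x hx
    obtain ⟨⟨h0a, h0b⟩, h1, h2⟩ := hPmem x hx
    rw [Metric.mem_closedBall, dist_zero_right]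
    have hx0 : |x 0| ≤ R / 4 := by
      have hs : |x 0 + x 2| ≤ R / 8 := abs_le.2 ⟨by linarith [(by positivity : 0 < 3 / (10 * cellAmp t))], by linarith⟩
      have := abs_sub (x 0 + x 2) (x 2)
      rw [add_sub_cancel_right] at this
      linarith
    have hsq : ‖x‖ ^ 2 ≤ R ^ 2 := by
      rw [Literature.Algebra.EuclideanLattices.norm_sq_fin_three]
      have e0 : x 0 ^ 2 ≤ (R / 4) ^ 2 := by rw [← sq_abs]; exact pow_le_pow_left₀ (abs_nonneg _) hx0 2
      have e1 : x 1 ^ 2 ≤ (R / 4) ^ 2 := by rw [← sq_abs]; exact pow_le_pow_left₀ (abs_nonneg _) h1 2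
      have e2 : x 2 ^ 2 ≤ (R / 8) ^ 2 := by rw [← sq_abs]; exact pow_le_pow_left₀ (abs_nonneg _) h2 2
      nlinarith
    exact (pow_le_pow_iff_left₀ (norm_nonneg x) hR0.le two_ne_zero).1 hsq
  -- the pointwise lower bound on `P`
  have hlow : ∀ x ∈ P, cellAmp t ^ 2 / 36 ≤ ‖sheetProfile t x‖ ^ 2 := by
    intro x hx
    obtain ⟨⟨h0a, h0b⟩, -, -⟩ := hPmem x hx
    have hu1 : 3 / 10 ≤ cellAmp t * (x 0 + x 2) := by
      rw [div_le_iff₀ (by positivity)] at h0a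
      linarith
    have hu2 : cellAmp t * (x 0 + x 2) ≤ 1 / 2 := by
      rw [le_div_iff₀ (by positivity)] at h0b
      linarith
    have hβ := oddBump_ge_sixth hu1 hu2
    have hv0 : sheetProfile t x 0 = cellAmp t * oddBump (cellAmp t * (x 0 + x 2)) := by
      simp [sheetProfile, sheetField_apply_zero, driftShift_apply_zero, driftShift_apply_two, mul_add]
    have h1 : (sheetProfile t x 0) ^ 2 ≤ ‖sheetProfile t x‖ ^ 2 := by
      rw [← sq_abs]
      exact pow_le_pow_left₀ (abs_nonneg _) (by simpa using PiLp.norm_apply_le (sheetProfile t x) 0) 2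
    have h2 : (cellAmp t / 6) ^ 2 ≤ (sheetProfile t x 0) ^ 2 := by
      rw [hv0]
      exact pow_le_pow_left₀ (by positivity) (by nlinarith) 2
    calc cellAmp t ^ 2 / 36 = (cellAmp t / 6) ^ 2 := by ring
      _ ≤ ‖sheetProfile t x‖ ^ 2 := h2.trans h1
  -- integrability on the ball
  have hcont : Continuous fun x : EuclideanSpace ℝ (Fin 3) => ‖sheetProfile t x‖ ^ 2 := by
    have hv : Continuous (sheetProfile t) :=
      continuous_iff_continuousAt.2 fun x => (hasFDerivAt_sheetProfile t x).continuousAt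
    exact (continuous_norm.comp hv).pow 2
  have hint : IntegrableOn (fun x : EuclideanSpace ℝ (Fin 3) => ‖sheetProfile t x‖ ^ 2)
      (Metric.closedBall (0 : EuclideanSpace ℝ (Fin 3)) R) :=
    hcont.continuousOn.integrableOn_compact (isCompact_closedBall _ _)
  have hPfin : volume P ≠ ∞ :=
    ((measure_mono hPsub).trans_lt (isCompact_closedBall (0 : EuclideanSpace ℝ (Fin 3)) R).measure_lt_top).ne
  -- the chain
  calc cellAmp t * R ^ 2 / 1440 = (volume P).toReal * (cellAmp t ^ 2 / 36) := by
        rw [hPvol, hvolIcc]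
        field_simp
        ring
    _ = ∫ x in P, (cellAmp t ^ 2 / 36 : ℝ) := by
        rw [setIntegral_const, smul_eq_mul, measureReal_def]
    _ ≤ ∫ x in P, ‖sheetProfile t x‖ ^ 2 :=
        setIntegral_mono_on (integrableOn_const hPfin) (hint.mono_set hPsub) hPmeas hlow
    _ ≤ ∫ x in Metric.closedBall (0 : EuclideanSpace ℝ (Fin 3)) R, ‖sheetProfile t x‖ ^ 2 :=
        setIntegral_mono_set hint (ae_of_all _ fun x => by positivity) hPsub.eventuallyLE

/-- **Clause (ix) of the rev-12 draft (thin energy) FAILS for the three-sheet profile** — verbatim, with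
`v ↦ sheetProfile`: the slice energy in `B̄(0,R)` at `t = −1` is `≥ R²/1440`, which no `K R^{7/4}` dominates.
So (ix) removes this (M)-free witness: the large-scale energy growth exponent (`2` for sheets) is what it measures.
[folklore] -/
theorem sheetProfile_not_thinEnergy :
    ¬ (∀ α : ℝ, 3 / 2 < α → α ≤ 3 → ∃ K : ℝ, 0 ≤ K ∧ ∀ t < 0, ∀ R : ℝ, 0 < R →
        ∫ x in Metric.closedBall (0 : EuclideanSpace ℝ (Fin 3)) R, ‖sheetProfile t x‖ ^ 2 ≤
          K * R ^ α * (-t) ^ (-((α - 1) / 2))) := by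
  intro h
  obtain ⟨K, hK, hKb⟩ := h (7 / 4) (by norm_num) (by norm_num)
  set M : ℝ := 1440 * K + 4 with hM
  have hMpos : 0 < M := by positivity
  have hM4 : 4 ≤ M := by linarith
  have hR : 4 / cellAmp (-1) ≤ M ^ 4 := by
    rw [cellAmp_neg_one, div_one]
    calc (4 : ℝ) ≤ M := hM4
      _ = M ^ 1 := (pow_one M).symm
      _ ≤ M ^ 4 := pow_le_pow_right₀ (by linarith) (by norm_num)
  have hlow := sheetProfile_energy_lower (by norm_num : (-1 : ℝ) < 0) hR
  have hup := hKb (-1) (by norm_num) (M ^ 4) (by positivity)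
  rw [cellAmp_neg_one, one_mul] at hlow
  have hpow : (M ^ 4 : ℝ) ^ (7 / 4 : ℝ) = M ^ 7 := by
    rw [show (M ^ 4 : ℝ) = M ^ (4 : ℝ) by norm_cast, ← Real.rpow_mul hMpos.le]
    norm_num
  rw [hpow, neg_neg, Real.one_rpow, mul_one] at hup
  have h := hlow.trans hup
  -- `M⁸/1440 ≤ K M⁷` with `M = 1440K + 4 > 1440K`: contradiction
  have h7 : 0 < M ^ 7 := by positivity
  have : M ^ 8 ≤ 1440 * K * M ^ 7 := by nlinarith
  nlinarith

end Summit.NavierStokesRegularity.NavierStokesRegularity.Theorems.PoloidalWindowRigidity.Negative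

end
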